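import Literature.AlgebraicGeometry.Resolution.LinearSectionsCharts
import Literature.Topology.KrullDimensionDrop
import Literature.AlgebraicGeometry.Resolution.RegularLocalRingsProofs
import Mathlib.RingTheory.KrullDimension.Zero
import HarnessLib

/-!
# Local dimension of a linear section versus its topological dimension

Topic: `Literature/AlgebraicGeometry/Resolution`. For a closed subscheme `ι : X ↪ ℙ^N_k`
(affine `ι` suffices), a point `x` and linear forms `a₀, …, a_{j-1}` (`LinearSectionsCharts`):

* `LinSec.ringKrullDim_quotient_cutIdeal_le` — **`dim 𝒪_{X,x}/(a₀,…,a_{j-1}) ≤ dim V(a₀,…,a_{j-1})`**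
  (the topological Krull dimension of the closed subset `X ∩ V(a) ⊆ X`): a chain of primes of
  `𝒪_{X,x}` containing the forms is a chain of generisations of `x` inside `V(a)`;
* `LinSec.cutIdeal_eq_maximalIdeal` — if moreover `V(a)` has dimension `≤ 0` and
  `𝒪_{X,x}/(a)` is regular, then `(a₀,…,a_{j-1})_x = 𝔪_x`: the forms generate the maximal ideal
  (used for "`π` is unramified at the points over the vertex", de Jong 1996, proof of 4.11).

Everything is proved; no named facts.

## References

* A. J. de Jong, *Smoothness, semi-stability and alterations*, Publ. Math. IHÉS 83 (1996), proof
  of 4.11 (p. 68). [DeJong1996]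
* R. Hartshorne, *Algebraic Geometry* (1977), I Thm. 7.2, II Thm. 8.18. [Hartshorne1977]
-/

noncomputable section

open CategoryTheory AlgebraicGeometry TopologicalSpace Opposite Order
open Literature.AlgebraicGeometry.Morphisms.ProjCech (grading PP)
open Literature.AlgebraicGeometry.Motives
open Literature.Topology

attribute [local instance] MvPolynomial.gradedAlgebra

namespace Literature.AlgebraicGeometry.Resolution

universe u

namespace LinSec

variable {k : Type u} [Field k] {N : ℕ} {X : Scheme.{u}} (ι : X ⟶ PP k N) [IsAffineHom ι]

section

variable (h : Fin (N + 1)) (x : X) (hx : x ∈ chart ι h) {j : ℕ} (a : Fin j → Fin (N + 1) → k)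

/-- The prime of `Γ(chart h, 𝒪_X)` under a prime of `𝒪_{X,x}/(a)`: contract along
`Γ(chart h) → 𝒪_{X,x} → 𝒪_{X,x}/(a)`. [folklore] -/
def primeBelow (P : PrimeSpectrum (X.presheaf.stalk x ⧸ cutIdeal ι x a)) :
    PrimeSpectrum Γ(X, chart ι h) :=
  ⟨(P.asIdeal.comap (Ideal.Quotient.mk (cutIdeal ι x a))).comap
    (X.presheaf.germ (chart ι h) x hx).hom, inferInstance⟩

/-- `primeBelow` is strictly monotone (contraction along a surjection, then along a
localisation map, both order embeddings on ideals). [folklore] -/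
theorem primeBelow_strictMono : StrictMono (primeBelow ι h x hx a) := by
  letI := (X.presheaf.germ (chart ι h) x hx).hom.toAlgebra
  haveI := isLocalization_stalk ι h x hx
  let e₁ := Ideal.orderEmbeddingOfSurjective (Ideal.Quotient.mk (cutIdeal ι x a))
    Ideal.Quotient.mk_surjective
  let e₂ := IsLocalization.orderEmbedding (ptIdeal ι h x hx).primeCompl (X.presheaf.stalk x)
  intro P Q hPQ
  have h1 : P.asIdeal < Q.asIdeal := hPQ
  have h2 := (e₂.strictMono (e₁.strictMono h1))
  exact h2

omit [IsAffineHom ι] in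
/-- The forms lie in `primeBelow P`. [folklore] -/
theorem secIdeal_le_primeBelow (P : PrimeSpectrum (X.presheaf.stalk x ⧸ cutIdeal ι x a)) :
    secIdeal ι h a ≤ (primeBelow ι h x hx a P).asIdeal := by
  intro s hs
  change Ideal.Quotient.mk (cutIdeal ι x a) (X.presheaf.germ (chart ι h) x hx s) ∈ P.asIdeal
  rw [Ideal.Quotient.eq_zero_iff_mem.mpr ?_]
  · exact zero_mem _
  · rw [cutIdeal_eq_map_secIdeal ι h hx]
    exact Ideal.mem_map_of_mem _ hs

/-- The point of the chart of a prime of `Γ(chart h, 𝒪_X)`. [folklore] -/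
def pointOfPrime (q : PrimeSpectrum Γ(X, chart ι h)) : X :=
  (isAffineOpen_chart ι h).fromSpec q

/-- The point of a prime lies in the chart. [folklore] -/
theorem pointOfPrime_mem (q : PrimeSpectrum Γ(X, chart ι h)) : pointOfPrime ι h q ∈ chart ι h := by
  have : pointOfPrime ι h q ∈ Set.range (isAffineOpen_chart ι h).fromSpec := ⟨q, rfl⟩
  rwa [IsAffineOpen.range_fromSpec] at this

/-- The prime of the point of a prime is the prime. [folklore] -/
theorem ptIdeal_pointOfPrime (q : PrimeSpectrum Γ(X, chart ι h)) :
    ptIdeal ι h (pointOfPrime ι h q) (pointOfPrime_mem ι h q) = q.asIdeal := by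
  have hU := isAffineOpen_chart ι h
  have : hU.primeIdealOf ⟨pointOfPrime ι h q, pointOfPrime_mem ι h q⟩ = q := by
    have e : (⟨pointOfPrime ι h q, pointOfPrime_mem ι h q⟩ : chart ι h) = hU.isoSpec.inv q := by
      apply Subtype.ext
      change (isAffineOpen_chart ι h).fromSpec q = _
      rw [← IsAffineOpen.isoSpec_inv_ι, Scheme.Hom.comp_apply]
      rfl
    rw [IsAffineOpen.primeIdealOf, e, ← Scheme.Hom.comp_apply, Iso.inv_hom_id]
    rfl
  exact congrArg PrimeSpectrum.asIdeal this

/-- `pointOfPrime` is injective. [folklore] -/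
theorem pointOfPrime_injective : Function.Injective (pointOfPrime ι h) :=
  (isAffineOpen_chart ι h).fromSpec.isOpenEmbedding.injective

/-- `pointOfPrime` turns inclusions of primes into specialisations. [folklore] -/
theorem pointOfPrime_specializes {q q' : PrimeSpectrum Γ(X, chart ι h)} (hqq' : q ≤ q') :
    pointOfPrime ι h q ⤳ pointOfPrime ι h q' :=
  ((PrimeSpectrum.le_iff_specializes q q').mp hqq').map (isAffineOpen_chart ι h).fromSpec.continuous

/-- A point of the chart whose prime contains the forms lies on `V(a)`. [folklore] -/
theorem pointOfPrime_mem_cutSet {q : PrimeSpectrum Γ(X, chart ι h)} (hq : secIdeal ι h a ≤ q.asIdeal) :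
    pointOfPrime ι h q ∈ cutSet ι a := by
  refine Set.mem_iInter.mpr fun i => ?_
  rw [mem_hyp_iff_linSec_mem_ptIdeal ι h (pointOfPrime_mem ι h q), ptIdeal_pointOfPrime]
  exact hq (Ideal.subset_span ⟨i, rfl⟩)

/-- **The chain map**: primes of `𝒪_{X,x}/(a)`, with the REVERSED inclusion order, to points of
`V(a)`; strictly monotone for the specialisation order `y ≤ y' ↔ y' ⤳ y`. [folklore] -/
def chainMap (P : (PrimeSpectrum (X.presheaf.stalk x ⧸ cutIdeal ι x a))ᵒᵈ) : ↥(cutSet ι a) :=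
  ⟨pointOfPrime ι h (primeBelow ι h x hx a (OrderDual.ofDual P)),
    pointOfPrime_mem_cutSet ι h a (secIdeal_le_primeBelow ι h x hx a _)⟩

/-- `chainMap` is strictly monotone into the specialisation order. [folklore] -/
theorem chainMap_strictMono :
    @StrictMono _ _ _ (specializationOrder ↥(cutSet ι a)).toPreorder (chainMap ι h x hx a) := by
  letI : PartialOrder ↥(cutSet ι a) := specializationOrder _
  intro P Q hPQ
  have hQP : OrderDual.ofDual Q < OrderDual.ofDual P := hPQ
  have hlt := primeBelow_strictMono ι h x hx a hQP
  have hsp : (chainMap ι h x hx a Q).1 ⤳ (chainMap ι h x hx a P).1 :=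
    pointOfPrime_specializes ι h hlt.le
  have hne : chainMap ι h x hx a Q ≠ chainMap ι h x hx a P := by
    intro heq
    have h1 := congrArg Subtype.val heq
    exact hlt.ne (pointOfPrime_injective ι h h1)
  -- `P < Q` in the specialisation order: `Q ⤳ P` and not `P ⤳ Q`
  change (chainMap ι h x hx a Q ⤳ chainMap ι h x hx a P) ∧
    ¬(chainMap ι h x hx a P ⤳ chainMap ι h x hx a Q)
  refine ⟨(subtype_specializes_iff _ _).mpr hsp, fun h' => hne ?_⟩
  exact (((subtype_specializes_iff _ _).mpr hsp).antisymm h').eq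

end

/-- **`dim 𝒪_{X,x}/(a₀,…,a_{j-1}) ≤ dim (X ∩ V(a₀,…,a_{j-1}))`** (topological Krull dimension of
the closed subset): chains of primes of `𝒪_{X,x}` containing the forms give chains of
generisations of `x` inside `V(a)`. [cite: Hartshorne1977, I Thm. 7.2] -/
theorem ringKrullDim_quotient_cutIdeal_le [QuasiSober X] (x : X) {j : ℕ}
    (a : Fin j → Fin (N + 1) → k) :
    ringKrullDim (X.presheaf.stalk x ⧸ cutIdeal ι x a) ≤ topologicalKrullDim ↥(cutSet ι a) := by
  obtain ⟨h, hx⟩ := exists_mem_chart ι x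
  haveI : QuasiSober ↥(cutSet ι a) := quasiSober_of_isClosed (isClosed_cutSet ι a)
  letI : PartialOrder ↥(cutSet ι a) := specializationOrder _
  rw [topologicalKrullDim_eq_krullDim, ringKrullDim, ← krullDim_orderDual]
  exact @krullDim_le_of_strictMono _ _ _ (specializationOrder ↥(cutSet ι a)).toPreorder _
    (chainMap_strictMono ι h x hx a)

/-- **The forms generate the maximal ideal at the points of a zero-dimensional regular section**:
if `dim V(a) ≤ 0` and `𝒪_{X,x}/(a)` is a regular local ring then `(a)_x = 𝔪_x`. [folklore] -/
theorem cutIdeal_eq_maximalIdeal [QuasiSober X] (x : X) {j : ℕ} (a : Fin j → Fin (N + 1) → k)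
    (hreg : IsRegularLocalRing (X.presheaf.stalk x ⧸ cutIdeal ι x a))
    (hdim : topologicalKrullDim ↥(cutSet ι a) ≤ 0) :
    cutIdeal ι x a = IsLocalRing.maximalIdeal (X.presheaf.stalk x) := by
  set R := X.presheaf.stalk x ⧸ cutIdeal ι x a
  have hd : ringKrullDim R ≤ 0 := (ringKrullDim_quotient_cutIdeal_le ι x a).trans hdim
  haveI : Ring.KrullDimLE 0 R := (Ring.krullDimLE_iff (n := 0) (R := R)).mpr hd
  haveI : IsDomain R := isDomain_of_isRegularLocalRing R
  have hF : IsField R := Ring.KrullDimLE.isField_of_isDomain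
  -- the kernel of `𝒪_{X,x} → R` (a field) is maximal
  have hmax : (cutIdeal ι x a).IsMaximal := by
    rw [← Ideal.Quotient.maximal_ideal_iff_isField_quotient] at hF
    exact hF
  exact IsLocalRing.eq_maximalIdeal hmax

end LinSec

end Literature.AlgebraicGeometry.Resolution

end
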